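import Summits.CriticalPhenomena.Ising3DConformalLimit.Theses.PrecisionLaplacian
import Summits.CriticalPhenomena.Ising3DConformalLimit.Theses.HyperoctahedralRP

/-!
# Disproof of `StableConeRPRigidity` (stmt-CriticalPhenomena-4800) — standing adversary's work file

**Verdict (gen 3, 2026-08-16): NO KILL IS POSSIBLE — the crux is TRUE on paper.**  The lead's picked line
`Lines/entire-profile-null-growth.lean` (seven stubs, composition kernel-checked) survives a stub-by-stub adversarial audit
(§S, first docblock after the gen-2 material below): every stub is a classical theorem or a verified two-page argument, so
`NineMirrorRigidityBelowFour` (nine-mirror RP + invariance + positivity + continuity + homogeneity of degree `-β`,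
`0 < β < 4` ⇒ `O(3)`-invariance) holds, and with it THIS CRUX (`β = 3 - α ∈ (1,2]`) and item 1979 `HRP2Rigidity`
(`β = 2Δ ∈ [1,2]`) — formally `of_nineMirrorRigidityBelowFour`.  Gen-2's verdict "RESISTS, as hard as 1979" is superseded:
the X-ray / Riesz-probe / Mellin transfer never visits the off-web great circles where §G/§V located the difficulty.  What
remains is formalisation risk, mapped in §S (two classical imports: Bernstein–Widder for S1, reflection positivity of
`‖x‖^{-γ}`, `1 ≤ γ < 3`, plus a Schur/Hadamard lemma for S5).  One TARGET is recorded against the reshaping announced in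
`PICKED.md`: the axial probe `K·|xᵢ|^{-δ}` is not a pointwise RP kernel (`axialProbe_not_RPAt`; repair given in §S).

Findings index (formal = Lean theorem in this file; paper = proof in a docblock):
* formal (gen 1–2) `crux_iff`, `of_HRP2Rigidity`, `homog_zero`, `isotropic_iff_norm`, `refl_coord/refl_add/refl_sub`,
          `even_of_nineInvariant`, `rp_pair_bound`, `not_invarianceOnlyRigidity` (REFUTED STRENGTHENING: RP is load-bearing).
* formal (gen 3, after §S) `of_nineMirrorRigidityBelowFour` (`C⁺ ⇒ crux ∧ 1979`), `axialProbe_not_RPAt` (TARGET: the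
          announced axial reshaping of S5 is false pointwise), `periodicTypeLiouville_tight` (S3's window `βT < 2π` is
          sharp: `cos`), `rieszProbe_posKernel/_homog/_nineInvariant` (3 of the 4 conjuncts of S5),
          `axisXRaysRadial_of_isotropic` (S6's conclusion is implied by isotropy), `entireMeridianProfiles_of_isotropic`
          (the other skeleton's closer S4 is crux-strength).
* paper §S  STUB AUDIT of both skeletons (entire-profile-null-growth S1–S7: all TRUE; cross-theorem-analyticity S1–S3, S5
          TRUE, S4 ⇔ crux), with the exact classical statement each import needs and the junk instances checked.
* paper §T′ NO ALGEBRAIC OBSTRUCTION AT ALL to the nine-fin envelope (no symmetry or reality assumed; reduces to §T via the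
          anti-holomorphic involutions `σₙ`); §G ERRATUM (one orthonormal triple's Siciak hull DOES continue off the fins,
          `tanh|b| < cos φ`, triage r1-3 confirmed) — both now moot for the crux.
* paper (gen 2, retained verbatim) §R three equivalent forms (CBF sections / Lévy-kernel RP / 1-D X-ray criterion);
          §G geometry of the fins; §L seven-plane lemma; §T Wick-hyperbolic no-go; §W window & load-bearing hypotheses;
          §P counterexample profile; §V second variation.
* numerics  none this generation (settled by proof, not search); earlier kit jobs j005536, j007404, j007729 (RP of `‖x‖^{-γ}`
          iff `γ ≥ 1`, supporting S5).
-/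

open scoped RealInnerProductSpace

namespace Summit.CriticalPhenomena.Ising3DConformalLimit.Cruxes.StableConeRPRigidity.Disproof

open Summit.CriticalPhenomena.Ising3DConformalLimit.Theses

/-- Ambient space `ℝ³`. -/
abbrev E := EuclideanSpace ℝ (Fin 3)

/-- `n` is one of the nine B₃ mirror normals `eᵢ`, `eᵢ + eⱼ`, `eᵢ - eⱼ` (exactly the clause of the crux). -/
def IsMirror (n : E) : Prop :=
  ∃ i j : Fin 3, i ≠ j ∧ (n = EuclideanSpace.single i 1 ∨ n = EuclideanSpace.single i 1 + EuclideanSpace.single j 1 ∨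
    n = EuclideanSpace.single i 1 - EuclideanSpace.single j 1)

/-- Invariance of a kernel under the nine mirrors. -/
def NineInvariant (K : E → ℝ) : Prop := ∀ n, IsMirror n → ∀ x, K (((ℝ ∙ n)ᗮ).reflection x) = K x

/-- Reflection positivity (finite sums over points of the open half-space) in the nine mirrors. -/
def NineRP (K : E → ℝ) : Prop :=
  ∀ n, IsMirror n → ∀ (m : ℕ) (p : Fin m → E) (c : Fin m → ℝ), (∀ a, 0 < inner ℝ (p a) n) →
    0 ≤ ∑ a, ∑ b, c a * c b * K (p a - ((ℝ ∙ n)ᗮ).reflection (p b))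

/-- `O(3)`-invariance. -/
def Isotropic (K : E → ℝ) : Prop := ∀ (R : E ≃ₗᵢ[ℝ] E) (x : E), K (R x) = K x

/-- Positive homogeneity of degree `β`. -/
def Homog (β : ℝ) (K : E → ℝ) : Prop := ∀ c : ℝ, 0 < c → ∀ x, K (c • x) = c ^ β * K x

/-- The Fourier-free potential equation `K ∗ (L_Φ f) = -f` of the crux. -/
def PotentialEq (α : ℝ) (Φ K : E → ℝ) : Prop :=
  ∀ f : E → ℝ, ContDiff ℝ 2 f → HasCompactSupport f → ∀ x,
    (∫ y, K (x - y) * ((1/2 : ℝ) * ∫ z, (f (y + z) + f (y - z) - 2 * f y) * (‖z‖ ^ (-(3 + α)) * Φ (‖z‖⁻¹ • z)))) = - f x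

/-- Admissible angular Lévy profile: continuous, `≥ 0`, `≢ 0` on the unit sphere, even. -/
def AdmissibleProfile (Φ : E → ℝ) : Prop :=
  ContinuousOn Φ (Metric.sphere 0 1) ∧ (∀ u ∈ Metric.sphere (0 : E) 1, 0 ≤ Φ u) ∧
    (∃ u ∈ Metric.sphere (0 : E) 1, 0 < Φ u) ∧ ∀ u, Φ (-u) = Φ u

/-- Positive continuous kernel on `ℝ³ ∖ 0`. -/
def PosKernel (K : E → ℝ) : Prop := ContinuousOn K {0}ᶜ ∧ ∀ x, x ≠ 0 → 0 < K x

/-- The crux with its hypotheses named (pure bookkeeping). -/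
theorem crux_iff :
    PrecisionLaplacian.StableConeRPRigidity ↔
      ∀ (α : ℝ) (Φ K : E → ℝ), 1 ≤ α → α < 2 → AdmissibleProfile Φ → PosKernel K → Homog (α - 3) K →
        PotentialEq α Φ K → NineInvariant K → NineRP K → Isotropic K := by
  constructor
  · intro h α Φ K h1 h2 hΦ hK hhom hpot hinv hrp R x
    exact h α Φ K h1 h2 hΦ.1 hΦ.2.1 hΦ.2.2.1 hΦ.2.2.2 hK.1 hK.2 hhom hpot
      (fun n hn => ⟨hinv n hn, hrp n hn⟩) R x
  · intro h α Φ K h1 h2 hc hnn hpos hev hKc hKp hhom hpot hmir R x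
    exact h α Φ K h1 h2 ⟨hc, hnn, hpos, hev⟩ ⟨hKc, hKp⟩ hhom hpot (fun n hn => (hmir n hn).1)
      (fun n hn => (hmir n hn).2) R x

/-- **4800 ≤ 1979.** Item stmt-1979 (`HyperoctahedralRP.HRP2Rigidity`, nine-mirror RP rigidity for every positive
continuous kernel of degree `-2Δ`, `1/2 ≤ Δ ≤ 1`) implies this crux with `Δ = (3 - α)/2`; the profile `Φ` and the
potential equation are simply discarded.  A refutation of this crux therefore refutes 1979 as well. -/
theorem of_HRP2Rigidity (h : HyperoctahedralRP.HRP2Rigidity) : PrecisionLaplacian.StableConeRPRigidity := by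
  intro α Φ K h1 h2 _ _ _ _ hKc hKp hhom _ hmir R x
  have hΔ1 : (1:ℝ)/2 ≤ (3 - α)/2 := by linarith
  have hΔ2 : (3 - α)/2 ≤ 1 := by linarith
  refine h ((3 - α)/2) K hΔ1 hΔ2 hKc hKp ?_ hmir R x
  intro c hc y
  have : (-(2 * ((3 - α) / 2)) : ℝ) = α - 3 := by ring
  rw [this]
  exact hhom c hc y

/-- Homogeneity of nonzero degree forces `K 0 = 0` (so positivity can only be asked off the origin, as the crux does). -/
theorem homog_zero {β : ℝ} (hβ : β ≠ 0) {K : E → ℝ} (h : Homog β K) : K 0 = 0 := by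
  have h2 := h 2 (by norm_num) 0
  rw [smul_zero] at h2
  have hne : (2:ℝ) ^ β ≠ 1 := by
    intro h1
    have hlog : Real.log ((2:ℝ) ^ β) = 0 := by rw [h1, Real.log_one]
    rw [Real.log_rpow (by norm_num : (0:ℝ) < 2)] at hlog
    have h2 : Real.log 2 ≠ 0 := ne_of_gt (Real.log_pos (by norm_num))
    exact hβ ((mul_eq_zero.mp hlog).resolve_right h2)
  have : ((2:ℝ) ^ β - 1) * K 0 = 0 := by linarith
  rcases mul_eq_zero.mp this with h0 | h0
  · exact absurd (sub_eq_zero.mp h0) hne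
  · exact h0

/-- `O(3)`-invariance is the same as being a function of the norm (reflections act transitively on spheres,
Mathlib `Submodule.reflection_sub`). -/
theorem isotropic_iff_norm (K : E → ℝ) : Isotropic K ↔ ∀ x y : E, ‖x‖ = ‖y‖ → K x = K y := by
  constructor
  · intro h x y hxy
    have := h ((ℝ ∙ (x - y))ᗮ).reflection x
    rw [Submodule.reflection_sub hxy] at this
    exact this.symm
  · intro h R x
    exact h _ _ (R.norm_map x)

/-- The hyperplane reflection written out. -/
theorem refl_apply (n x : E) : ((ℝ ∙ n)ᗮ).reflection x = x - (2 * ⟪n, x⟫ / ‖n‖ ^ 2) • n := by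
  rw [Submodule.reflection_orthogonal_apply, Submodule.reflection_singleton_apply]
  simp only [RCLike.ofReal_real_eq_id, id_eq, neg_sub, two_smul]
  rw [← add_smul]
  congr 1
  ring


/-! ## Coordinate action of the nine mirrors -/

theorem inner_single_one (i : Fin 3) (x : E) : ⟪(EuclideanSpace.single i (1:ℝ) : E), x⟫ = x i := by
  rw [EuclideanSpace.inner_single_left]; simp

theorem norm_sq_single_one (i : Fin 3) : ‖(EuclideanSpace.single i (1:ℝ) : E)‖ ^ 2 = 1 := by
  rw [← real_inner_self_eq_norm_sq, inner_single_one]; simp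

theorem norm_sq_single_add {i j : Fin 3} (hij : i ≠ j) :
    ‖(EuclideanSpace.single i (1:ℝ) + EuclideanSpace.single j (1:ℝ) : E)‖ ^ 2 = 2 := by
  rw [← real_inner_self_eq_norm_sq, inner_add_left, inner_single_one, inner_single_one]
  simp [hij, hij.symm]; norm_num

theorem norm_sq_single_sub {i j : Fin 3} (hij : i ≠ j) :
    ‖(EuclideanSpace.single i (1:ℝ) - EuclideanSpace.single j (1:ℝ) : E)‖ ^ 2 = 2 := by
  rw [← real_inner_self_eq_norm_sq, inner_sub_left, inner_single_one, inner_single_one]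
  simp [hij, hij.symm]; norm_num

/-- Coordinate mirror `eᵢ`: sign flip of the `i`-th coordinate. -/
theorem refl_coord (i : Fin 3) (x : E) :
    ((ℝ ∙ (EuclideanSpace.single i (1:ℝ) : E))ᗮ).reflection x = x - (2 * x i) • EuclideanSpace.single i (1:ℝ) := by
  rw [refl_apply, inner_single_one, norm_sq_single_one, div_one]

/-- Anti-diagonal mirror `eᵢ + eⱼ`: `(xᵢ, xⱼ) ↦ (-xⱼ, -xᵢ)`. -/
theorem refl_add {i j : Fin 3} (hij : i ≠ j) (x : E) :
    ((ℝ ∙ (EuclideanSpace.single i (1:ℝ) + EuclideanSpace.single j (1:ℝ) : E))ᗮ).reflection x =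
      x - (x i + x j) • (EuclideanSpace.single i (1:ℝ) + EuclideanSpace.single j (1:ℝ)) := by
  rw [refl_apply, inner_add_left, inner_single_one, inner_single_one, norm_sq_single_add hij]
  congr 1; ring

/-- Diagonal mirror `eᵢ - eⱼ`: swap of `xᵢ` and `xⱼ`. -/
theorem refl_sub {i j : Fin 3} (hij : i ≠ j) (x : E) :
    ((ℝ ∙ (EuclideanSpace.single i (1:ℝ) - EuclideanSpace.single j (1:ℝ) : E))ᗮ).reflection x =
      x - (x i - x j) • (EuclideanSpace.single i (1:ℝ) - EuclideanSpace.single j (1:ℝ)) := by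
  rw [refl_apply, inner_sub_left, inner_single_one, inner_single_one, norm_sq_single_sub hij]
  congr 1; ring

theorem isMirror_single (i : Fin 3) : IsMirror (EuclideanSpace.single i (1:ℝ)) := by
  refine ⟨i, i + 1, ?_, Or.inl rfl⟩
  fin_cases i <;> decide

/-- The three coordinate mirrors compose to `-1`: a nine-mirror-invariant kernel is even. -/
theorem even_of_nineInvariant {K : E → ℝ} (h : NineInvariant K) (x : E) : K (-x) = K x := by
  have key : -x = ((ℝ ∙ (EuclideanSpace.single 0 (1:ℝ) : E))ᗮ).reflection
      (((ℝ ∙ (EuclideanSpace.single 1 (1:ℝ) : E))ᗮ).reflection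
        (((ℝ ∙ (EuclideanSpace.single 2 (1:ℝ) : E))ᗮ).reflection x)) := by
    simp only [refl_coord]
    ext k
    fin_cases k <;> simp <;> ring
  rw [key, h _ (isMirror_single 0), h _ (isMirror_single 1), h _ (isMirror_single 2)]

/-- The `m = 2` shadow of reflection positivity: for `p, q` strictly on the positive side of the mirror `n`,
`K(p - θq) + K(q - θp) ≤ K(p - θp) + K(q - θq)`.  (Coefficients `(1,-1)`.) -/
theorem rp_pair_bound {K : E → ℝ} (h : NineRP K) {n : E} (hn : IsMirror n) (p q : E)
    (hp : 0 < ⟪p, n⟫) (hq : 0 < ⟪q, n⟫) :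
    K (p - ((ℝ ∙ n)ᗮ).reflection q) + K (q - ((ℝ ∙ n)ᗮ).reflection p) ≤
      K (p - ((ℝ ∙ n)ᗮ).reflection p) + K (q - ((ℝ ∙ n)ᗮ).reflection q) := by
  have := h n hn 2 ![p, q] ![1, -1] (by intro a; fin_cases a <;> simpa)
  simp [Fin.sum_univ_two] at this
  linarith

/-! ## A refuted strengthening: reflection positivity is load-bearing

Dropping `Φ`, the potential equation AND reflection positivity (keeping continuity, positivity, homogeneity of
degree `α - 3` and invariance under the nine mirrors) gives a FALSE statement: `K x = (Σ x_k⁴)/‖x‖⁶` at `α = 1`. -/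

/-- The crux with `Φ`, the potential equation and RP deleted. FALSE (`not_invarianceOnlyRigidity`). -/
def InvarianceOnlyRigidity : Prop :=
  ∀ (α : ℝ) (K : E → ℝ), 1 ≤ α → α < 2 → PosKernel K → Homog (α - 3) K → NineInvariant K → Isotropic K

/-- The quartic witness `(x₀⁴ + x₁⁴ + x₂⁴)/‖x‖⁶`. -/
noncomputable def quarticKernel (x : E) : ℝ := (∑ k, (x k) ^ 4) / ‖x‖ ^ 6

theorem sum_four_eq (x : E) : (∑ k, (x k) ^ 4) = x 0 ^ 4 + x 1 ^ 4 + x 2 ^ 4 := by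
  simp [Fin.sum_univ_three]

theorem norm_sq_eq_sum (x : E) : ‖x‖ ^ 2 = x 0 ^ 2 + x 1 ^ 2 + x 2 ^ 2 := by
  rw [EuclideanSpace.norm_eq, Real.sq_sqrt (by positivity)]
  simp [Fin.sum_univ_three]

theorem quarticKernel_nineInvariant : NineInvariant quarticKernel := by
  intro n hn x
  obtain ⟨i, j, hij, h | h | h⟩ := hn <;> subst h
  · unfold quarticKernel
    rw [LinearIsometryEquiv.norm_map, refl_coord, sum_four_eq, sum_four_eq]
    congr 1
    fin_cases i <;> simp <;> ring
  · unfold quarticKernel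
    rw [LinearIsometryEquiv.norm_map, refl_add hij, sum_four_eq, sum_four_eq]
    congr 1
    fin_cases i <;> fin_cases j <;> simp at hij ⊢ <;> ring
  · unfold quarticKernel
    rw [LinearIsometryEquiv.norm_map, refl_sub hij, sum_four_eq, sum_four_eq]
    congr 1
    fin_cases i <;> fin_cases j <;> simp at hij ⊢ <;> ring

theorem quarticKernel_homog : Homog ((1:ℝ) - 3) quarticKernel := by
  intro c hc x
  have hc' : (c:ℝ) ^ ((1:ℝ) - 3) = (c ^ 2)⁻¹ := by
    rw [show ((1:ℝ) - 3) = -(2:ℝ) by norm_num, Real.rpow_neg hc.le, Real.rpow_two]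
  unfold quarticKernel
  rw [hc', norm_smul, Real.norm_eq_abs, abs_of_pos hc, sum_four_eq, sum_four_eq]
  simp only [PiLp.smul_apply, smul_eq_mul]
  rcases eq_or_ne x 0 with hx | hx
  · subst hx; simp
  · have hnx : ‖x‖ ≠ 0 := norm_ne_zero_iff.mpr hx
    field_simp

theorem quarticKernel_pos (x : E) (hx : x ≠ 0) : 0 < quarticKernel x := by
  unfold quarticKernel
  have hn : 0 < ‖x‖ := norm_pos_iff.mpr hx
  apply div_pos _ (by positivity)
  rw [sum_four_eq]
  have h2 : 0 < ‖x‖ ^ 2 := by positivity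
  rw [norm_sq_eq_sum] at h2
  nlinarith [sq_nonneg (x 0), sq_nonneg (x 1), sq_nonneg (x 2), sq_nonneg (x 0 ^ 2), sq_nonneg (x 1 ^ 2),
    sq_nonneg (x 2 ^ 2), sq_nonneg (x 0 ^ 2 - x 1 ^ 2), sq_nonneg (x 1 ^ 2 - x 2 ^ 2), sq_nonneg (x 0 ^ 2 - x 2 ^ 2)]

theorem quarticKernel_continuousOn : ContinuousOn quarticKernel {0}ᶜ := by
  unfold quarticKernel
  apply ContinuousOn.div
  · apply Continuous.continuousOn
    simp only [sum_four_eq]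
    fun_prop
  · fun_prop
  · intro x hx
    have : x ≠ 0 := hx
    positivity

/-- **Refuted strengthening.** Nine-mirror invariance + continuity + positivity + homogeneity do NOT give
isotropy: `quarticKernel` at `α = 1`; the reflection `e₀ ↦ (3e₀ + 4e₁)/5` changes its value from `1` to `337/625`.
Moral for provers: every proof of the crux must use reflection POSITIVITY (or the potential equation), not only
the symmetry. -/
theorem not_invarianceOnlyRigidity : ¬ InvarianceOnlyRigidity := by
  intro h
  have hiso := h 1 quarticKernel le_rfl (by norm_num) ⟨quarticKernel_continuousOn, quarticKernel_pos⟩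
    quarticKernel_homog quarticKernel_nineInvariant
  set e₀ : E := EuclideanSpace.single 0 (1:ℝ) with he₀
  set w : E := (3/5 : ℝ) • EuclideanSpace.single 0 (1:ℝ) + (4/5 : ℝ) • EuclideanSpace.single 1 (1:ℝ) with hw
  have hn0 : ‖e₀‖ = 1 := by
    have : ‖e₀‖ ^ 2 = 1 := by rw [he₀]; exact norm_sq_single_one 0
    nlinarith [norm_nonneg e₀]
  have hnw : ‖w‖ = 1 := by
    have : ‖w‖ ^ 2 = 1 := by rw [norm_sq_eq_sum, hw]; simp; norm_num
    nlinarith [norm_nonneg w]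
  have key := hiso ((ℝ ∙ (e₀ - w))ᗮ).reflection e₀
  rw [Submodule.reflection_sub (by rw [hn0, hnw])] at key
  unfold quarticKernel at key
  rw [hn0, hnw, sum_four_eq, sum_four_eq, hw, he₀] at key
  simp at key
  norm_num at key


/-! ## §0  Reading of the elaborated statement (no junk)

`rc 0`, one `sorry` for the probe.  Symbol by symbol: `α : ℝ` with `1 ≤ α < 2`; `Φ` enters only through `Φ (‖z‖⁻¹ • z)`
(values off the unit sphere are irrelevant; at `z = 0` the factor `‖z‖ ^ (-(3+α)) = 0` by `Real.rpow` conventions and the point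
is null anyway); both Bochner integrals in `PotentialEq` are genuine for `C²` compactly supported `f` (inner integrand
`O(‖z‖^(-1-α))` at `0`, `O(‖z‖^(-3-α))` at `∞`; outer `‖y‖^(α-3)` locally, `‖y‖^(-6)` at `∞`), and if they were not the
hypothesis would read `0 = -f x`, i.e. be unsatisfiable — harmless direction.  `K` is UNIQUELY determined by `(α, Φ)`:
`K̂ = 1/ψ_Φ`, `ψ_Φ(k) = c_α ∫_{S²} |k·u|^α Φ(u) dσ(u)`, `c_α = ∫₀^∞ (1 - cos t) t^(-1-α) dt` (difference of two solutions has
Fourier support in `{ψ = 0} = {0}`, is a polynomial, homogeneous of negative degree, hence `0`).  Homogeneity forces `K 0 = 0`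
(`homog_zero`), consistent with positivity being asked only off `0`.  The mirror clause quantifies over ordered pairs `i ≠ j`, so
`eᵢ - eⱼ` and `eⱼ - eᵢ` both occur: RP is asked on both sides of each mirror (equivalent, by invariance).  Conclusion
`Isotropic K` ⇔ `K` radial (`isotropic_iff_norm`) ⇔ `ψ_Φ` radial ⇔ `Φ` constant on the sphere (the cosine transform of order
`α ∉ 2ℕ` is injective on even functions).  Hypotheses are satisfiable for EVERY admissible `Φ` (Bogdan–Sztonyk: the potential
kernel of a non-degenerate symmetric stable law is continuous, positive, homogeneous); the isotropic Riesz kernel satisfies all of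
them including nine-mirror RP (`‖x‖^(-s)` is RP for `s = 3 - α ≥ d - 2 = 1`, Frank–Lieb / FILS78).  Nothing vacuous, nothing
trivial; `simp/decide/aesop` obviously inapplicable.

## §R  Three equivalent forms (paper; standard facts: Bernstein–Widder, BCR Thm 4.2.8-type representation on `(0,∞) × ℝ²`,
## Schilling–Song–Vondraček Thm 6.2/7.3)

Fix a mirror `n` (unit) and write points as `t n + q`, `q ⊥ n`.

(R1) `RP_n(K)` + `K∘θ_n = K`  ⇔  `K(tn+q) = ∫∫ e^{-λ|t| + iξ·q} dμ(λ,ξ)`, `μ ≥ 0`  ⇔  for every `ξ ⊥ n`,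
`s ↦ K̂(√s n + ξ) = 1/ψ_Φ(√s n + ξ)` is a Stieltjes function  ⇔  `F_{n,ξ}(s) := ψ_Φ(√s n + ξ)` is COMPLETE BERNSTEIN (CBF):
holomorphic on `ℂ ∖ (-∞,0]`, `Im F ≥ 0` on the upper half plane, `F ≥ 0` on `(0,∞)`.  (`K` is locally integrable, degree
`α - 3 > -3`, so its distributional Fourier transform is the pointwise one; "a.e. `ξ`" upgrades to "every `ξ`" by continuity.)
So THE CRUX ⇔ [`Φ` admissible, `B₃`-invariant, all nine families of sections of `ψ_Φ` CBF ⇒ `Φ` constant].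

(R2) LÉVY-KERNEL FORM.  Let `J(z) := ‖z‖^(-3-α) Φ(ẑ)` (the Lévy density; degree `-(3+α) ∈ (-5,-4]`, NOT locally integrable,
but `ψ_Φ(k) = ∫ (1 - cos k·z) J(z) dz` converges absolutely).  Splitting `1 - cos(k_n t + ξ·q)` and using evenness of `J` in `q`,
`ψ(k_n n + ξ) = ψ(ξ) + 2∫₀^∞ (1 - cos k_n t) J̃(t,ξ) dt`, `J̃(t,ξ) := ∫ cos(ξ·q) J(tn+q) dq`.  If `J` is `RP_n` then (BCR on the open
half-space, no integrability at `0` needed) `J̃(t,ξ) = ∫ e^{-λt} μ_ξ(dλ)` and `∫₀^∞ (1-cos k_n t) e^{-λt} dt = k_n²/(λ(λ²+k_n²))`, so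
`ψ(k_n n+ξ) = ψ(ξ) + ∫ 2s/(λ(λ²+s)) μ_ξ(dλ)` (`s = k_n²`) is CBF; conversely a CBF representation defines `μ_ξ ≥ 0` reproducing
`J̃(·,ξ)` (the map `J̃ ↦ ψ` determines `J̃` on `t > 0`).  HENCE `RP_n(K) ⇔ RP_n(J)` for each `n`, and
  THE CRUX ⇔ HRP-RIGIDITY IN DEGREE `-(3+α)`:  [`J = ‖z‖^(-3-α)Φ(ẑ)`, `Φ` admissible, `J` nine-mirror invariant and RP
  (finite sums over points of the open half-spaces) ⇒ `Φ` constant].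
This is Fourier-free and `Φ` enters linearly and positively (cheapest object for Gram tests).  [= gen-1 finding A3.]

(R3) ONE-DIMENSIONAL CRITERION.  With `j_n(q) := J(n+q)` on the affine plane `{x·n = 1}` and `β := 3+α`: `RP_n(J)` ⇔ for every
direction `ξ̂ ⊥ n`, `r ↦ r^(2-β) ĵ_n(r ξ̂)` is completely monotone on `(0,∞)`, where `ĵ_n(rξ̂)` is the 1-D Fourier transform of
the X-RAY PROFILE `p(x) := ∫ J(n + xξ̂ + y p̂) dy` (`p̂ = n × ξ̂`); explicitly `p(x) = ½(1+x²)^(-(2+α)/2) D_Φ(m̂_x; p̂)` with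
`m̂_x = (n + xξ̂)/√(1+x²)` sweeping the meridian through `n` and `ξ̂`, and `D_Φ(m;p̂) := ∫₀^{2π} |cos θ|^(1+α) Φ(cos θ m + sin θ p̂)dθ`
(weighted Funk transform over the great circle through `m, p̂`, weight vanishing at `±p̂`).  Equivalently
`p(x) = ∫₀^∞ Re (t - ix)^(-(2+α)) τ(dt)`, `τ ≥ 0` (positive superposition of ridge profiles).  At `α = 1` (`β = 4`) this is:
`u ↦ q(√u)` is a Stieltjes function, where `q'' = -p`, `q` even, decaying (`q(x) = ∫ₓ^∞ (y-x)p(y)dy`); isotropic check: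
`p = (1+x²)^(-3/2)`, `q(√u) = √(1+u) - √u = 1/(√(1+u)+√u)` Stieltjes.  The 1-D cones are large (all mixtures
`∫ (t²+x²)^(-(2+α)/2) t^(1+α)… dm(t)` and much more); all content is in the coupling of the circle's worth of conditions per pencil
through the single function `Φ` (tomography over the pencils of great circles through `±p̂`, `p̂ ∈ n⊥`).

## §G  Geometry of the constraint (paper)

Put `g := ψ_Φ/‖k‖^α` on `S²` (real-analytic a posteriori, `B₃`-invariant, `> 0`).  For the pencil of pole `n` and the meridian
through the equator point `ξ̂ ∈ n⊥`, parametrize by latitude `θ` (`k̂ = cos θ ξ̂ + sin θ n`); then `√s = tan θ`, `s + 1 = sec²θ`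
and `F_{n,ξ̂}(s) = (cos θ)^(-α) g(θ)`.  The cut plane `ℂ ∖ (-∞,0]` is the strip `0 < Re θ < π/2` (all `Im θ`), the upper half
plane is the upper half-strip, `s → -1` (complex NULL vector `ξ̂ + i n`) is `Im θ → +∞`, `s ∈ (-1,0)` is the line `Re θ = 0`
(points `cosh T ξ̂ + i sinh T n` of the de Sitter real form `dS_n = {x + iyn : x ⊥ n, |x|²-y²=1}`), `s < -1` is `Re θ = π/2`
(the two-sheeted form `H_n = {yn + ix}`).  So per leaf: `g` extends holomorphically to `{Re θ ∉ (π/2)ℤ}` (all four quarter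
strips, by `θ ↦ -θ`, `θ ↦ θ + π`), with Pick sign rules on the upper half-strips and the NEVANLINNA GROWTH BOUND
`|g(θ₁ + iT)| ≤ C e^{(2+α)|T|}/sin 2θ₁` (from `|F(s)| ≤ C(1+|s|²)/Im s`, `s + 1 ≈ 4e^{-2T}e^{2iθ₁}`).
* The union of the complexified meridians of pole `n` is the LEVI-FLAT real hypersurface `Σ_n = {z ∈ S²_ℂ : (Re z × Im z)·n = 0}`
  (3-dimensional); `∪_n Σ_n` is the preimage of the `B₃` mirror planes under `z ↦ Re z × Im z`, its complement (preimage of the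
  open Weyl chambers) is a non-empty open set where NO condition bears.  Inside `Σ_n`, singularities of `g` are allowed exactly on
  `dS_n ∪ H_n` (minus a neighbourhood of the real equator/poles).
* `Σ_n ∩ Σ_{n'} = S² ∪ C_a^ℂ`, `a = n × n'` (the complexified great circle through `n, n'`, a COMMON leaf): two fins never cross
  with distinct leaves away from the real sphere, so neighbourhoods of `Σ_n ∪ Σ_{n'}` are locally products (domain of holomorphy):
  there is no Bochner-tube / Hartogs mechanism continuing `g` off the fins.  Consequently the GLOBAL step planned for item 1979
  ("continue across the de Sitter real forms to the whole quadric, Nevanlinna growth ⇒ polynomial ⇒ constant") has no engine: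
  leafwise holomorphy + growth are compatible with non-polynomial `g` (per leaf e.g. `(1 - ζ⁴)^{1/2}`-type functions have
  infinitely many harmonics and growth `|ζ|²`).  Rigidity, if true, must come from POSITIVITY across leaves (§P).
* LOCAL step is fine: at a real point the leaves of two pencils with distinct great circles are transversal real-analytic
  foliations with uniform complex extension (full strips) and uniform bounds, so Bernstein's separate-analyticity theorem gives
  `g ∈ C^ω(S²)`; at a real point the two tube-neighbourhoods `{|Im φ₁| < δ}`, `{|Im φ₂| < δ}` (longitudes about two poles are
  local holomorphic coordinates) DO cross with distinct leaves, and the local tube lemma yields a Grauert tube of radius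
  depending only on the pencil geometry, not on `Φ` (uniform exponential decay of the harmonics of admissible `g`: a compactness
  statement, not rigidity).
* Real-sphere consequence: `g` can have NO real singular curve or point (every transversal kink is seen by some pencil inside an
  open arc), so all freedom is in the complex domain — consistent with the planner's `Σ|kᵢ|^α` (kinks on coordinate circles are
  invisible to coordinate pencils only).

## §L  Seven-plane isotropy lemma (paper; rigorous modulo (R1) and the Nevanlinna bound)

LEMMA.  Under the hypotheses of the crux, `ψ_Φ(k) = ψ_Φ(e₁)·‖k‖^α` for every `k` in the three coordinate planes and in the four
planes orthogonal to the body diagonals `(±1,±1,±1)`.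
Proof.  These seven great circles are exactly those containing two NON-orthogonal poles (`eᵢ` & `(eᵢ±eⱼ)/√2` at 45°;
`(eᵢ+eⱼ)/√2` & `(eᵢ+eₖ)/√2` at 60°).  On such a circle `C` (angle `ω`), pencil `p` allows singularities of `g|_C` only on the
lines `Re ω ∈ ω_p + (π/2)ℤ`; two non-orthogonal poles give disjoint line families, so `g|_C` is ENTIRE, `π`-periodic, with
`|g(ω+iT)| ≤ C e^{(2+α)|T|}` uniformly (near a line of one family use the other family's bound).  Hence `g|_C = Σ_m A_m e^{2imω}`
with `A_m = 0` for `2|m| > 2 + α`, i.e. `|m| ≤ 1` because `α < 2`.  The modes `m = ±1` are killed by `B₃`: on `{k₃ = 0}` by the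
quarter turn `ω ↦ ω + π/2`, on a body-diagonal circle by the 3-fold rotation (a signed 3-cycle in `B₃`) `ω ↦ ω + 2π/3`.  The seven
circles form a connected net, so the constants agree.  ∎
REMARKS. (i) At `α = 2` the bound admits `m = ±2` (`cos 4ω`, the trace of the cubic harmonic): the lemma and the crux degenerate
together — `α < 2` is load-bearing, `α ≥ 1` is not used.  (ii) In terms of `Φ`: for each of the seven planes `Π`, the angular
measure `A ↦ ∫_{S²} |u_Π|^α 1_A(u_Π/|u_Π|) Φ(u) dσ(u)` on the unit circle of `Π` is uniform (2-D cosine transform of non-even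
order is injective).  (iii) For every other leaf the allowed line set is non-empty and no entire-ness follows.  (iv) Suggested
next step for PROVERS: expand `g` in the transversal coordinate at the net, `g = g₀ + k̂₃² G₂(ω) + …` near `{k₃=0}`; if the
leafwise continuation + growth pass to the jets with the same exponent, `G₂, G₄, …` are forced into `span{1, cos 4ω}` and then
into constants by the diagonal pencils; the honest obstacle is the loss in the Cauchy estimate transversal to a fin (thickness
`δ(T) ~ e^{-2|T|}` from the two-constants theorem gives only `e^{(6+α)|T|}` for `G₂`).

## §T  The product ("Wick-hyperbolic") ansatz and a no-go theorem (paper, complete proof)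

CRITERION.  Let `U` be a real `B₃`-invariant form of degree `2m`, `U > 0` on `ℝ³∖0`, `γ > 0`, `ψ := ‖k‖^(α-2mγ) U^γ`
(homogeneous of degree `α`, `B₃`-invariant).  On the section `k = √s n + ξ̂`: `‖k‖² = s+1` and `U(√s n + ξ̂) =: R(s)` is a real
polynomial of degree `m` in `s` (even in `√s` by `θ_n`-invariance), `R > 0` on `[0,∞)`.  Hence
  `F(s) = U(n)^γ (s+1)^(α/2-mγ) ∏_j (s - s_j)^γ`,  `s_j` the roots of `R`.
If all `s_j` are real (then negative), `F` is a product of CBF powers with total exponent `α/2 ≤ 1` ⇒ CBF (for `mγ ≤ α/2`; for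
larger `γ` the finer count `γ·#{s_j ∈ (-1,0)} ≤ 1`, `γ·#{s_j < -1} ≤ α/2` suffices, by the argument principle on the half-strip).
If some `s_j ∉ ℝ`, `F` has a branch point (or, for `γ ∈ ℤ`, a zero) in the open upper half plane ⇒ not CBF.  So:
  nine-RP of `K = 𝓕⁻¹[1/ψ]`  ⇔  for all nine `n` and all `ξ ⊥ n`, every root `w` of `U(ξ + w n) = 0` is purely imaginary
  ("`U` is WICK-HYPERBOLIC": the real polynomial `(ξ,t) ↦ U(ξ + itn)` on `n⊥ ⊕ ℝ` is Gårding-hyperbolic in `t`; for `U = ‖k‖^(2m)`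
  it is the wave form `(|ξ|²-t²)^m`).
And if a Wick-hyperbolic non-radial `U` existed, then for small `γ`: `Φ := T_α⁻¹[U^γ/‖k‖^(2mγ)] = Φ₀ + γ·T_α⁻¹[log(U/‖k‖^(2m))] + O(γ²)`
in `C^∞(S²)` is `> 0`, `K > 0`, and the crux (and item 1979, for every `Δ ∈ [1/2, 3/2)`) would be FALSE.

THEOREM.  A Wick-hyperbolic `B₃`-invariant positive form is `c‖k‖^(2m)`.  (Only the three coordinate pencils and ONE diagonal
leaf are used.)
Proof.  Write `U = F(k₁²,k₂²,k₃²)`, `F` symmetric of degree `m`, `F > 0` on the closed orthant minus `0`; let `eₗ` be the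
elementary symmetric functions of `y = (k₁²,k₂²,k₃²)`.
(a) Coordinate pencil `e₃`, leaf through `ξ = (ξ₁,ξ₂,0)`: `U(ξ + w e₃) = F(ξ₁²,ξ₂²,w²)`; roots `w ∈ iℝ` ⇔ roots `r = w²` real
`≤ 0` ⇔ (H1) for all `y₁,y₂ ≥ 0`, `y₃ ↦ F(y₁,y₂,y₃)` has only real (negative) roots.
(b) Diagonal pencil `(e₁+e₂)/√2`, leaf through `ξ = a(e₁-e₂)/√2 + b e₃`: `k = ((a+it)/√2, (-a+it)/√2, b)`, `y₁ = (a+it)²/2`,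
`y₂ = ȳ₁`, `y₃ = b²` ⇔ (H2) for all real `a,b`, `t ↦ F((a+it)²/2, (a-it)²/2, b²)` has only real roots.
(c) FACE IDENTITY.  `G(y₁,y₂) := F(y₁,y₂,0) = F(y₁,0,y₂)`.  (H1) at `y₂ = 0`: `G(1,r)` real-rooted with negative roots, so
`G = c∏_j (y₂ + ρ_j y₁)`, `ρ_j > 0`.  (H2) at `b = 0`, `a = 1`: `t ↦ G(y,ȳ)`, `y = (1+it)²/2`, real polynomial of degree `2m`;
but `ȳ + ρ_j y = 0` forces `ρ_j = 1`, `t = ±1`, so the number of real roots is `2·#{j : ρ_j = 1}`; real-rootedness forces all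
`ρ_j = 1`: `G = c(y₁+y₂)^m`.  Hence `F - c e₁^m` vanishes on the three coordinate faces: `F = c e₁^m + e₃·Q(e₁,e₂,e₃)`,
`Q` symmetric of weighted degree `m-3` (so `m ≤ 2` ⇒ radial already).
(d) NEWTON POLYGON.  Apply (H1) at `(y₁,y₂) = (1,ε)`, `ε → 0⁺`, and put `y₃ = -1-ε+ρ` so that `e₁ = ρ` exactly,
`e₂ = -1 - ε - ε² + (1+ε)ρ`, `e₃ = -ε(1+ε) + ερ`.  All `m` roots `ρ → 0`.  The monomial `e₃·e₁^i e₂^j e₃^k` of `e₃Q`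
(`i+2j+3k = m-3`) has leading term `±q ρ^i ε^(k+1)`, corrections only up-and-right; so the Newton diagram consists of `(m,0)`
and points `(i,κ)`, `κ = k+1 ≥ 1`, with `i = m - 3κ - 2j ≤ m - 3κ`.  The last edge of the lower hull ends at `(m,0)` and has
slope `-1/μ` with `μ = (m-i₀)/κ₀ ≥ 3`; its edge polynomial is `X^{i₀} H(X^p)` with `p ≥ 3`, `H(0) ≠ 0`, `deg H ≥ 1`, which has a
non-real root; Newton–Puiseux then produces a non-real root `ρ(ε) ≈ X ε^{1/μ}` of `F(1,ε,·)` for small `ε > 0`, contradicting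
(H1) — unless the diagram is `{(m,0)}`, i.e. `Q = 0`.  ∎
COROLLARIES. (1) No counterexample among `Φ = T_α⁻¹[(U/‖k‖^(2m))^γ]`, finite products `∏ U_j^{γ_j}`, finite sums, or continuous
log-superpositions `exp ∫ log(U_λ) dm(λ)` (branch points/log-potential supports off `(-∞,0]` cannot cancel), nor among orbit
sums of elliptic or one-axis atoms `Σ_g (1 + c((gk̂)·v)²)^γ`, `Σ_g ((gk)ᵀA(gk))^{α/2}` (each atom has section roots with
`Re w = -c·(ξ·v)(n·v)/(…) ≠ 0`; for CONTINUOUS mixtures `∫ (kᵀAk)^{α/2} dM(A)` smearing moves branch points to the boundary of the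
swept locus, so any `B₃`-invariant `supp M` with boundary or interior still leaves branch points, resp. `∂̄ ≠ 0`, inside the cut
plane on generic leaves, and the closed supports without boundary are `SO(3)`-orbits (radial) or finite), nor `g = G(p₄,p₆)` with
`G` entire (then every leaf restriction is an entire `π`-periodic
function of growth `e^{(2+α)|T|}`, a quadratic trigonometric polynomial on every meridian through the 18 poles).  (2) NEW explicit
smooth full-spectrum COORDINATE-RP anisotropic exponents: `U = ‖k‖⁴ - c Σkᵢ⁴ = (Σy)² - cΣy²`, `0 < c < 1`, satisfies (H1)
(quadratic in `y₃`: leading coefficient `1 - c > 0`, discriminant `4c[(y₁+y₂)² + (1-c)(y₁²+y₂²)] ≥ 0`, root sum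
`-2(y₁+y₂)/(1-c) < 0`, root product `[(y₁+y₂)² - c(y₁²+y₂²)]/(1-c) > 0`) and violates (H2) already on the leaf `b = 0, a = 1`
(`F = (1 - c/2)(1 + t⁴) + (3c - 2)t²`, discriminant in `t²` equal to `8c(c-1) < 0`: four non-real roots).  So
`ψ = ‖k‖^(α-4γ)(‖k‖⁴ - cΣkᵢ⁴)^γ` (small `γ > 0`) is RP in `e₁,e₂,e₃` and not in `e₁ ± e₂` — the diagonal mirrors are
load-bearing, concretely and smoothly.  (3) The HRP card's `K₁` (product of three axis-ellipsoids,
`m = 3`) and every `B₃`-symmetrised product of quadratic forms fail the diagonal mirrors by the Theorem, not by accident.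
(4) Numerical sanity check of (H1)∧(H2) for `m ≤ 8`: kit job j007404 (penalty minimisation over `Q`; expected: no zero of the
penalty away from `Q = 0`).

## §W  Window and load-bearing hypotheses (paper + formal)

* RP is load-bearing: `not_invarianceOnlyRigidity` (formal).  The six DIAGONAL mirrors are load-bearing: §T(2), the planner's
  `Σ|kᵢ|^α`, the HRP card's `K₁, K₂`.  Finite harmonic content is impossible even for one mirror (top harmonic `H_ℓ`, `ℓ ≥ 4`,
  gives `(s+1)^{(α-ℓ)/2}` at the null point, phase sweep `> π`; `H_ℓ(ξ̂ + in) ≠ 0` for all but finitely many `ξ̂` since a harmonic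
  polynomial vanishing on the null cone is `0`).
* `α < 2` is essential (§L(i)); at `α = 2` the inner integral of `PotentialEq` diverges logarithmically for generic `f` (Bochner
  value `0`, hypothesis unsatisfiable) and `ψ_Φ` would be a `B₃`-invariant quadratic form, i.e. isotropic for every `Φ`: the
  statement degenerates, it does not fail.  `1 ≤ α` (the Ising window `Δ ≤ 1`) is used by NO mechanism found: everything above
  holds for `α ∈ (0,2)`; provers may ignore `h1 : 1 ≤ α` except through `of_HRP2Rigidity`.
* Mechanism-critic delimiter (card hyperoctahedral-rp-rigidity, critic note 2026-08-15): `(Σ∂ᵢ⁴)² ‖x‖^(-2D₀) + A‖x‖^(-2D₀-8)`,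
  `D₀ ≥ 1/2`, is nine-RP (pointwise finite sums on open half-spaces), `B₃`-invariant, positive, non-radial: window-free HRP is
  false in degree `≤ -9`.  Why this cannot descend to our windows: for `K = P(∂)K₀` with `K₀ = ‖x‖^(-s)` radial RP (`s ≥ 1`) one
  needs `P(κ) ≥ 0` on the nine Wick frames `V_n = {-λn + iq}`; `P` is REAL on all of them iff `P` is invariant under the nine
  `π`-rotations `-θ_n`, i.e. `P ∈ ℝ[κ]^O` (chiral octahedral invariants = `B₃`-invariants in even degree; first odd one in degree
  9); in degrees `2,4,6` the only invariants non-negative on all nine forward/null cones are multiples of `p₂ = Σκᵢ²` resp.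
  `p₂²`, `p₂³`, `p₂p₄`… with the `p₄`, `p₆` coefficients forced to `0` (e.g. `p₄` on the diagonal null cone equals
  `-2q_a⁴ - 2q_a²q₃² + 3q₃⁴/2`, indefinite; `p₆` is `≥ 0` on the `e₁` null cone and `≤ 0` on the diagonal one), so anisotropy
  first appears with `p₄²` (order 8, degree `≤ -9`).  Our `J` has degree in `(-5,-4]`, our `K` in `[-2,-1)`: both would need
  operator order `≤ 3`: radial.  Also NB: those degree `≤ -9` kernels are not locally integrable, and the Stieltjes-section
  criterion (R1) does not apply to them (their distributional `K̂` sections `(s+1)^{-β}Q(s)²` have complex zeros); no conflict.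
* Growth heuristic vs. threshold: the Nevanlinna bound allows harmonic degree `ℓ ≤ 2Δ_J - 1 = 2 + α < 4` on the `J`-side
  (`ℓ ≤ 2 - α` on the `K`-side) for POLYNOMIAL angular parts only; it does not exclude transcendental `g` (§G), so the distance
  between our window (`2Δ_J < 5`) and the critic's constructive threshold (`2Δ ≥ 9`) is real and open ("infinite cubic-harmonic
  content below 9/2" in the critic's words; §T removes the finitely generated part of that territory).

## §P  What a counterexample must be; why no `¬`-theorem; advice

* A counterexample `Φ` has `g = ψ_Φ/‖k‖^α` real-analytic, `B₃`-invariant, CONSTANT on the seven-circle net (§L), transcendental and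
  not finitely generated by invariant forms (§T), with leafwise continuations holomorphic off the lines over equators/poles,
  growth `≤ e^{(2+α)|T|}`, jump conditions `Im g(0⁺+iT) ≥ 0` (`T > 0`) over equators and `Im(e^{iαπ/2} g) ≥ 0` over poles, and
  `T_α⁻¹ g ≥ 0`.  I cannot exclude such an object, nor construct one; the dimension count for its singular curve (two real
  conditions vs two free real functions, after `B₃`) leaves room for isolated rigid solutions only.
* Even with such a `Φ` in hand, a Lean proof of `¬ StableConeRPRigidity` is out of reach: instantiating `PotentialEq` needs the
  Fourier theory of homogeneous distributions / stable semigroups absent from Mathlib.  A kill would be filed as certified numerics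
  + paper proof (refuted-substantive evidence), not as a gate theorem.  Conversely a positive proof needs (R1) formalised — same gap.
* For PROVERS of 4800/1979: (i) staff them as one problem (`of_HRP2Rigidity`); (ii) do not plan on continuation to the whole
  quadric (§G); (iii) usable rigorous milestones: LOCAL real-analyticity with a UNIVERSAL Grauert radius, the seven-plane lemma,
  the Wick-hyperbolicity no-go, and the second-variation proposition of §V below (a worked template for an induction on jets at
  the seven-circle net); (iv) the 2-D analogue (`B₂`, four mirrors, `Φ` on `S¹`) should be settled first: there every leaf IS the
  circle itself, §L applies verbatim with two non-orthogonal poles on the one circle, and gives the full theorem: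
  PLANAR RIGIDITY (paper, by the proof of §L): an even continuous `Φ ≥ 0` on `S¹` whose `α`-cosine transform has CBF sections for
  the four `B₂` mirrors is constant, for every `α ∈ (0,2)`.  [= gen-1 finding A5, now with a two-line proof.]

## §V  Second variation at the seven-circle net (paper; the positivity lever, worked to second order)

PROPOSITION.  Under the hypotheses of the crux, normalise `g = ψ_Φ/‖k‖^α ≡ 1` on the net (§L).  Then the second NORMAL derivative
of `g` across each of the seven planes is constant along the corresponding great circle: near `{k₃ = 0}`,
`g = 1 + c₀ k̂₃² + O(k̂₃⁴)` with `c₀ ∈ ℝ` independent of the polar angle `ω`; likewise (constants `c₀'`) at the four body-diagonal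
circles.
Proof (sketch with all exponents).  Write `g = 1 + k̂₃² G₂(ω) + O(k̂₃⁴)`, `G₂` real-analytic, even, `π/2`-periodic.  Pencil `e₁`,
leaf with equator point `(0, cos φ, sin φ)`: `k̂ = (sin θ, cos θ cos φ, cos θ sin φ)`, so `k̂₃ = cos θ sin φ`, `ω = π/2 - θ + O(φ²)`
and `g(φ,θ) = 1 + φ² a(θ) + O(φ⁴)`, `a(θ) = cos²θ G₂(π/2 - θ)`.  (1) CONTINUATION: by the cross theorem (real `φ`-segment ×
`θ`-strip) `g` is jointly holomorphic on `{|Im φ| < δ(θ)}` with `δ(θ₁+iT) ≈ c e^{-2|T|} sin 2θ₁` (relative extremal function of the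
half-strip) and `|g| ≲ e^{(2+α)|T|}` there; hence `a` extends to the strip `0 < Re θ < π/2` with the Cauchy bound
`|a| ≲ e^{(6+α)|T|}`, i.e. `G₂` is holomorphic on `0 < Re ω < π/2` with `|G₂| ≲ e^{(4+α)|Im ω|}`; the diagonal pencil
`(e₁+e₂)/√2` (pole at `ω = π/4`, `a_diag(θ) = cos²θ G₂(θ - π/4)`) gives the strips `|Re ω| < π/4` (mod `π/2`): `G₂` is ENTIRE,
`G₂ = Σ_j c_j cos 4jω` with `4j ≤ 4 + α < 6`: `G₂ = c₀ + c₁ cos 4ω`.  (On a body-diagonal circle the 3-fold symmetry allows only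
`cos 6jω` and `6 > 4 + α` gives `G₂ = c₀'` already.)  (2) POSITIVITY kills `c₁`: `F_φ(s) = (s+1)^{α/2} + φ² A(s) + R`,
`A = (s+1)^{α/2-1} G₂(π/2-θ(s))`, and near `s = -1` (`ρ := |s+1| → 0`, `e^{-4iθ} = (1+s)²/(1+i√s)⁴ ≈ 16/(s+1)²`):
`A ≈ 8c₁ (s+1)^{α/2-3} + c₀(s+1)^{α/2-1}`, `|R| ≲ φ⁴ρ^{-5}` (k-th Taylor term `≲ φ^{2k} ρ^{-2k-1}`, convergent for `ρ ≫ φ`).  In the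
window `φ^{4/(4+α)} ≪ ρ ≪ φ^{2/3}` (non-empty because `α < 2`) the term `φ²·8c₁(s+1)^{α/2-3}` dominates both `(s+1)^{α/2}` and
`R`, so `arg F_φ = arg c₁ + (α/2 - 3)·arg(s+1) + o(1)`; as `arg(s+1)` runs over a sub-interval of `(0,π)` of length
`> 2π/(3 - α/2)` (possible iff `α < 2`) the argument sweeps more than `2π`, so `Im F_φ < 0` somewhere: contradiction with CBF unless
`c₁ = 0`.  ∎
REMARKS. (i) The sign of `c₀` is NOT constrained at this order (its effect `φ²c₀(s+1)^{α/2-1}` is comparable to `F₀` only at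
`ρ ~ φ²`, outside the region `ρ ≫ φ` controlled by the jets; there `g(φ,·)` is governed by its own receding singularities at
heights `T ≈ ½ log(1/φ)` on the allowed lines).  (ii) Iterating: at order `φ^{2k}` the Cauchy bound allows modes `cos 4jω` with
`4j ≤ 2 + α + 2k`, and the dominance window against `F₀` exists iff `k < 2 j_max(k)`: orders `k = 1,3,5,…` have windows, even
orders are marginal (constants, not exponents, decide) — so an all-orders induction needs either sharper transversal estimates
than `δ ~ e^{-2|T|}` or a second idea; but every step of this kind only ever uses `α < 2`, never `α ≥ 1`.  (iii) The same
computation at a GENERIC leaf is empty (there `Im F₀ > 0` on the whole boundary except the real segment).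
-/

/-- (R2) Nine-mirror invariance and reflection positivity of the Lévy kernel `J(z) = ‖z‖^(-(3+α)) Φ(ẑ)`. -/
def LevyKernelNineRP (α : ℝ) (Φ : E → ℝ) : Prop :=
  NineInvariant (fun z => ‖z‖ ^ (-(3 + α)) * Φ (‖z‖⁻¹ • z)) ∧ NineRP (fun z => ‖z‖ ^ (-(3 + α)) * Φ (‖z‖⁻¹ • z))

/-- (R2) The Fourier-free, potential-free form of the crux: HRP-rigidity in degree `-(3+α)` for kernels with a non-negative
continuous angular part.  CLAIM (paper, §R): `PrecisionLaplacian.StableConeRPRigidity ↔ LevyKernelRigidity`.  Not formalisable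
today (needs `K̂ = 1/ψ_Φ`); recorded as the recommended target of any numerical attack and of any future formal bridge. -/
def LevyKernelRigidity : Prop :=
  ∀ (α : ℝ) (Φ : E → ℝ), 1 ≤ α → α < 2 → AdmissibleProfile Φ → LevyKernelNineRP α Φ →
    ∀ u ∈ Metric.sphere (0 : E) 1, ∀ v ∈ Metric.sphere (0 : E) 1, Φ u = Φ v

/-- (§T) Wick-hyperbolicity of a form `U` (given on the complexification `ℂ³`) in the nine mirror directions: every root `w` of `U(ξ + w n)`, `ξ ⊥ n`, is purely
imaginary.  THEOREM (paper, §T): a `B₃`-invariant form, positive off `0`, with this property is `c‖k‖^(2m)`; consequently no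
kernel with Lévy exponent `‖k‖^(α-2mγ) U^γ` refutes the crux. -/
def WickHyperbolic (U : (Fin 3 → ℂ) → ℂ) : Prop :=
  ∀ n : E, IsMirror n → ∀ ξ : E, ⟪ξ, n⟫ = 0 → ∀ w : ℂ,
    U (fun i => (ξ i : ℂ) + w * (n i : ℂ)) = 0 → w.re = 0


/-! # Gen-3 findings (2026-08-16, refuter-cdisprove-stmt-CriticalPhenomena-4800-g3-0)

## §S  Adversarial audit of the two skeletons' stubs

Conventions: TRUE = proof re-derived in full AND the registered Lean statement read for junk instances (negative
constants, `0 ^ (-δ) = 0`, empty index types, `y = 0`, `K ≡ 0`, `M ≤ 0`); IMPORT = the one classical theorem a Lean proof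
must vendor.  Nothing below is a positive landing: provers land the stubs; this file records why none of them can be
broken and where a Lean proof can slip.

### Picked line `Lines/entire-profile-null-growth.lean` (lead's `PICKED.md`, 2026-08-16T01:13Z)

S1 `HalfPlaneContinuation` — TRUE (any `ι`).  Configuration `{s_a n̂} ∪ {s_a n̂ - y}` (`s_a > 0`, `y ⊥ n`):
`p_a - θp_b = (s_a+s_b)n̂`, `p_a - θp'_b = (s_a+s_b)n̂ + y`, `p'_a - θp_b = (s_a+s_b)n̂ - y`, `p'_a - θp'_b = (s_a+s_b)n̂`;
evenness + `θₙ`-invariance give `K(sn̂ - y) = K(-(sn̂ - y)) = K(θₙ(sn̂ + y)) = K(sn̂ + y)`, so the Gram matrix is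
`[[A,B],[B,A]]` and the coefficient vectors `(c,c)`, `(c,-c)` give `A ± B ⪰ 0`: `F_±(s) := K(sn̂) ± K(sn̂+y)` are positive
definite on the semigroup `((0,∞),+)` (forms `[F(s_a+s_b)]`), continuous (`K` continuous off `0`; `sn̂ + y ≠ 0`), bounded
on `[t₀,∞)` (slab hypothesis).  IMPORT (Bernstein–Widder: Widder, *The Laplace Transform*, Ch. VI §21; BCR 1984 Ch. 8
Thm 1.4 / Ex 1.5, the card's cite): a continuous exponentially convex function on `(0,∞)` is `∫_ℝ e^{-λs} dμ(λ)`, `μ ≥ 0`;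
boundedness at `+∞` forces `supp μ ⊂ [0,∞)`.  Then `F := ½(𝓛μ₊ - 𝓛μ₋)` is holomorphic on `Re t > 0`, equals `K(tn̂+y)`
for real `t`, and `|F(t)| ≤ ½(F₊+F₋)(Re t) = K((Re t)n̂)`.  Junk: `y = 0` gives `F₋ = 0` (fine); `ι` empty makes `n ≠ 0`
impossible (vacuous).  In-tree help: `IsMirrorRPKernel.isPosSemidefKernelOn` + `mirrorKernel_symm_of_even`
(`Literature/MathematicalPhysics/QuantumFieldTheory/MirrorRPKernel.lean`) deliver the symmetric PSD kernel on the
half-space; `OSDistributionSpaceSemigroup.lean` has an `exists_laplace_measure` for contraction semigroups (check its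
hypotheses before planning on it).

S2 `StripTilingEntire` — TRUE.  `tan` maps `{0 < Re θ < π/2}` biholomorphically onto `{Re t > 0}`
(`Re tan(a+ib) = sin 2a/(cos 2a + cosh 2b) > 0`; the boundary lines go to `iℝ`), and `Re cos(a+ib) = cos a cosh b > 0`
there, so `G_j(ω) := exp(-β Log cos θ)·F_j(tan θ)`, `θ = γ_j + π/2 - ω`, is holomorphic on the strip `(γ_j, γ_j+π/2) + iℝ`
and equals `κ` on its base; the reflection `ω ↦ 2γ_j + π - ω` and the period `π` carry it to `ℂ ∖ L_j`,
`L_j = γ_j + (π/2)ℤ + iℝ`.  `L₁ ∩ L₂ = ∅` iff `γ₂ - γ₁ ∉ (π/2)ℤ` (hypothesis); on each strip of `ℂ ∖ (L₁ ∪ L₂)` the two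
functions agree (identity theorem from the real base interval), so `G := G₁` off `L₁`, `:= G₂` off `L₂` is entire.
Growth: `|cos(a+ib)|² = ½(cos 2a + cosh 2b)` gives `(|cos θ|·Re tan θ)^{-β} = (2(cos 2a + cosh 2b))^{β/2}/sin^β 2a
≤ 2^β e^{β|b|}/sin^β 2a`; using, at each `Re ω`, the family whose lines are at distance `≥ d₀ = ½ min(Δ, π/2-Δ)` gives
`C' = 2^β C/sin^β(2d₀)`.  Junk: `C < 0` vacuous; `C = 0` forces `κ ≡ 0` (fine); `β = 0` fine.

S3 `PeriodicTypeLiouville` — TRUE (contour shift; in tree: `Literature.Analysis.Complex.integral_mul_exp_eq_of_periodic`).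
SHARP: `periodicTypeLiouville_tight` (formal) — `cos`, `T = 2π`, `β = 1`, `βT = 2π`, not constant.  So the window
`β < 4` of the whole line (period `π/2`) cannot be widened by this route; consistent with the mechanism critic's
anisotropic nine-RP kernels at `β ≥ 9` (§W) and with the first-order check under S4.

S4 `PlanarRigidityLemma` (S1–S3 ⇒ `PlanarFourLineRigidity`, `0 < β < 4`) — TRUE, bookkeeping verified:
`κ(ω) = k(cos ω e₁ + sin ω e₂)`; `n = e₁, y = e₂`: `κ(π/2-θ) = (cos θ)^{-β} k(tan θ e₁ + e₂)` (`γ₁ = 0`);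
`n = e₁+e₂`, `n̂ = (e₁+e₂)/√2`, `y = (e₂-e₁)/√2`: `sin θ n̂ + cos θ y = (cos(3π/4-θ), sin(3π/4-θ))`, so
`κ(3π/4-θ) = (cos θ)^{-β} k(tan θ n̂ + y)` (`γ₂ = π/4`); symmetries `κ(π-ω) = κ ω` (`θ_{e₁}`), `κ(3π/2-ω) = κ ω`
(`θ_{e₁+e₂} : (x,y) ↦ (-y,-x)`), period `π` (`θ_{e₁}θ_{e₂} = -1`); `C = max(k n̂₁, k n̂₂)` from S1's bound and homogeneity;
the quarter turn `θ_{e₂}θ_{e₁-e₂} : (x,y) ↦ (y,-x)` gives period `π/2`; S3 with `T = π/2` needs `β·π/2 < 2π ⇔ β < 4`.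
FIRST-ORDER CROSS-CHECK (independent of S1–S3): for `k = ‖y‖^{-β}(1 + ε cos 4ω)` the domination bound of S1 at
`t = ε' + i` compares `ε·ε'^{-β/2-2}` with `ε'^{-β}` and is violated as `ε' → 0` iff `β < 4` — the same threshold.

S5 `SchurRieszProbe` — TRUE for `1 ≤ γ < 3`.  Three conjuncts are formal below (`rieszProbe_posKernel`, `_homog`,
`_nineInvariant`).  IMPORT for the fourth: `‖x‖^{-γ}` is mirror-RP in `ℝ³` for every hyperplane iff `γ ≥ 1 = d-2`
(FILS78; Frank–Lieb 2010): its Fourier transform `c_γ‖k‖^{γ-3}` has sections `(s+|q|²)^{-(3-γ)/2}`, Stieltjes iff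
`0 < (3-γ)/2 ≤ 1`; x-side `‖tn̂+ξ‖^{-γ} = ∬ e^{-λ|t|}cos(q·ξ) w_γ(λ,q) dλ dq`, `w_γ ≥ 0` — then `IsMirrorRPKernel.integral` +
`IsMirrorRPKernel.exp_mul_cos` (in tree) give RP — and the Hadamard product of two PSD Gram matrices is PSD: Mathlib
`Matrix.PosSemidef.hadamard` (`Mathlib/Analysis/Matrix/Order.lean`), ALREADY packaged for symmetric mirror-RP kernels as
`Summit.…Theorems.HRP2Rigidity.Negative.rp_mul` (tree file `Theorems/HRP2Rigidity/Negative/Descent.lean`, landed by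
the 1979 disprover; importable), next to `hrp2Rigidity_descent` (Δ-monotonicity by the same Schur step).  Kit j007729
(on the item): Gram matrices of `‖x‖^{-γ}` PSD for `γ ∈ {1,1.5,2,2.5}`, not for `γ < 1`.
TARGET — the reshaping announced in `PICKED.md` (axial weights `|xᵢ|^{-δ}`, `0 < δ < 1`, "Schur product with the PD
Toeplitz matrix `[h(s_j - s_l)]`") is FALSE as a pointwise statement: for `n ⊥ eᵢ` every diagonal vector `p - θₙ p ∈ ℝn`
has `xᵢ = 0`, where `|xᵢ|^{-δ} = +∞` on paper and `0` in Lean (`Real.zero_rpow`), so the Toeplitz matrix has an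
infinite / junk diagonal; `axialProbe_not_RPAt` (formal) exhibits the failing `2`-point configuration `{e₀+e₂, e₀}`,
`c = (1,-1)`, for EVERY positive `K` and every `δ ≠ 0`.  REPAIR: use `w_ε(x) = (xᵢ² + ε²)^{-δ/2}`, a positive-definite
function of `xᵢ` (Fourier transform `∝ |ξ|^{(δ-1)/2} K_{(1-δ)/2}(ε|ξ|) > 0`), for which `K·w_ε` IS RP in the four mirrors
`n ⊥ eᵢ` (Schur with the PSD Toeplitz matrix `[w_ε((p_a)ᵢ - (p_b)ᵢ)]`; NOT in the five mirrors moving `xᵢ`), run S6 for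
`K·w_ε` (not homogeneous, but four-line RP and invariance of its X-ray survive verbatim), and let `ε → 0` in the X-ray
`∫ K(y+seᵢ)(s²+ε²)^{-δ/2} ds ↑ ∫ K(y+seᵢ)|s|^{-δ} ds` (monotone convergence, `δ < 1`), which is homogeneous of degree
`-(β+δ-1)`; four-line RP passes to the pointwise limit (`IsMirrorRPKernel.of_tendsto`).  The Riesz version as
registered needs no repair.

S6 `XRayReduction` — TRUE given `PlanarFourLineRigidity` (`1 < β' < 5`).  For `n ⊥ eᵢ` the grids `ỹ_a + jh eᵢ`
(`1 ≤ j ≤ N`) stay in the open half-space and `θₙ` fixes `eᵢ`, so nine-RP gives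
`∑_ab c_a c_b N⁻¹∑_{j,l} K(v_ab + (j-l)h eᵢ) ≥ 0`, `v_ab = ỹ_a - θỹ_b` (`⟪v_ab,n⟫ > 0`, so no grid vector is `0`);
`N⁻¹∑_{j,l} = ∑_{|k|<N}(1-|k|/N)K(v+kheᵢ) → ∑_{k∈ℤ}` (absolutely summable, `β' > 1`), then `h∑_k → ∫K(v+seᵢ)ds`
(`h → 0`; continuous integrand, envelope `M(‖v‖²+s²)^{-β'/2}`).  The X-ray kernel on `eᵢ^⊥ ≅ ℝ²` is continuous, positive,
homogeneous of degree `-(β'-1) ∈ (-4,0)`, invariant and RP under the four mirrors `⊥ eᵢ`, which act on `eᵢ^⊥` as the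
square-lattice lines; planar rigidity makes it radial.  Formal sanity: `axisXRaysRadial_of_isotropic`.

S7 `MellinAxialSymmetry` — TRUE.  `F_ŷ(z) = ∫K(ŷ+seᵢ)(1+s²)^{-z}ds` is holomorphic on `Re z > (1-β)/2`; the hypothesis
gives `F_ŷ = F_ŷ'` on `{γ/2 : 1 ≤ γ < min(3,5-β)}`, an interval with interior iff `β < 4`, inside the half-plane because
`β > 0`; identity theorem; `F_ŷ` is the Laplace transform of the push-forward of `K(ŷ+seᵢ)ds` under `u = log(1+s²)`
(density `[K(ŷ+seᵢ)+K(ŷ-seᵢ)]·e^u/(2√(e^u-1))`, locally integrable), and positive measures with equal finite Laplace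
transforms on a half-line coincide; `θ_{eᵢ}` removes the symmetrisation: `K(ŷ+seᵢ) = K(ŷ'+seᵢ)` for all `s` and all unit
`ŷ, ŷ' ⊥ eᵢ`, i.e. `K` is invariant under `O(2) × 1` about EVERY axis, hence under `O(3)`.

CONCLUSION OF THE AUDIT.  `NineMirrorRigidityBelowFour` is a theorem (paper), hence so are this crux and item 1979
(`of_nineMirrorRigidityBelowFour`, formal).  For `4 ≤ β < 9` nine-RP rigidity is OPEN (the method stops at `cos 4ω`; the
first constructive anisotropic examples are `P(∂)²‖x‖^{-s}`, `deg P = 4`, `β = s+8 ≥ 9`, §W) — irrelevant to the Ising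
window.  Lean risk, decreasing: S1 (Bernstein–Widder), S5 (Riesz RP; Schur is in tree), S6 (Fejér / Riemann limits), S7
(parametric holomorphy + Laplace uniqueness), S2 (branch of `Log cos`, gluing), S3, S4.  Cross-check with the 1979
disprover's file (`Cruxes/HRP2Rigidity/Disproof.lean`, cycle 2): no counterexample candidate there either (F4 dead
families, F7 profile, F8 LP search), and its conditional `Δ = 1/2` global step (F9) is subsumed by `C⁺`.

### Registered skeleton `Lines/cross-theorem-analyticity.lean` (5 stubs; not picked)

S1 `stub_halfPlaneExtension` TRUE (the OS/GNS form of the same Laplace–Fourier representation; the domination bound at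
real points is `rp_pair_bound`); S2 `stub_bernsteinCross` TRUE (Bernstein–Siciak bounded cross theorem; in the bounded
case no measurability issue arises — `t ↦ f(z₁,t)` is continuous by Vitali / normal families — and
`h_{A,D}(z) = (2/π)|arg((r+z)/(r-z))|` for the diameter `A` of the disc `D`, so a concentric complex cube of radius `κr`
lies in the hull; `M < 0` vacuous, `M = 0` gives `f = 0`); S3 `stub_grauertTube` TRUE given S2 (three independent lattice
normals with `⟪x,n⟫ ≠ 0` at every `x ≠ 0`, fins of `-n` by `θₙ`-invariance; real homogeneity propagates to the local
extensions by uniqueness, so `F(z) := ‖Re z‖^{-β}F₁(z/‖Re z‖)` is locally a fixed-`λ` transport, hence holomorphic);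
S5 `stub_fourierExtinction` TRUE and elementary (`g_u` entire, `2π`-periodic, even by `θ_{e₁}`, `π`-periodic by evenness of
`K`, type `≤ β ≤ 2` ⇒ `g_u = A(u) + B(u)cos 2ω`, `B = 0` outright if `β < 2`; at `β = 2` the quarter turns make `K` constant
on `{x₃=0}` and `{x₂=0}`, hence (by `θ_{e₁-e₂}`) on the equator `{x₁=0}`, so `A+B = K(u) = K(e₁) = A-B`; every point of
`S²` lies on a meridian through `±e₁`; no continuity hypothesis is needed and none is assumed).  S4
`stub_meridianGapPinning` is CRUX-STRENGTH in both directions — it follows from the crux's conclusion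
(`entireMeridianProfiles_of_isotropic`, formal) and implies the crux through S5 — so it cannot be stub-false, and after §S
it is TRUE; but its own envelope/positivity engines are no longer the economical road: derive it from
`NineMirrorRigidityBelowFour`.

## §T′  No algebraic obstruction to the nine-fin envelope (strengthens §T; paper; now moot for the crux)

Let `U = ⋃ₙ Uₙ ∪ (ℝ³∖0)`, `Uₙ = {x + iy n̂ : x ∈ ℝ³, x·n̂ ≠ 0, y ∈ ℝ}` (the nine K-side fins on which RP makes `K`
holomorphic, §G in x-space form), viewed in `P² ⊃ ℝP²`.  CLAIM: an algebraic curve `{P = 0} ⊂ P²` (`P` homogeneous of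
degree `m`, complex coefficients, no symmetry assumed) disjoint from `U` is supported on the null conic `C₀ = {z·z = 0}`.
Proof.  Disjointness from `Uₙ`: for every real `ξ ⊥ n̂`, all roots `w` of `P(ξ + w n̂)` are purely imaginary; the root set is
then invariant under `w ↦ -w̄`, so `(P* ∘ θₙ)(ξ + wn̂) = conj P(conj(ξ - w̄… )) = conj P(ξ - w̄ n̂)` has the same roots and
degree (`P(n̂) ≠ 0` as `[n̂] ∈ ℝP² ⊂ U`), i.e. `P*∘θₙ = λ·P` on every REAL line through `[n̂]`; a rational function constant on
infinitely many lines through a point where it is regular is constant, so `P*∘θₙ = λₙ P` globally: the curve is invariant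
under the nine anti-holomorphic involutions `σₙ[z] = [θₙ z̄]`, hence under `σₙσₙ' = θₙθₙ'`, which generate the rotation
group `O ≅ S₄`; for square-free `P` (root sets ignore multiplicity), `P∘g = χ(g)P` with `χ ∈ {1, sign}`.  `χ = 1` on the
Klein group `{diag(±1,±1,±1), det = 1}` forces the three exponents of each monomial to have equal parity; `m` odd ⇒
`z₁z₂z₃ ∣ P` ⇒ `P(e₁) = 0`, a real zero — excluded; so `P = F(z₁²,z₂²,z₃²)` with `F` cyclically symmetric (3-cycles are
even) and symmetric unless `χ = sign`, in which case `F(y₂,y₁,y₃) = -F(y)` vanishes on `y₁ = y₂` and `P(1,1,0) = 0` —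
excluded.  So `P` is `B₃`-invariant; `P* = λₙ P∘θₙ = λₙ P` makes `P = e^{iγ}·(real form)`, non-vanishing on the connected
`ℝ³∖0`, hence definite; §T finishes: `P = c(z·z)^{m/2}`.  ∎
CONSEQUENCES.  (i) Engine (a) of the cross-theorem line meets no algebraic obstruction whatsoever.  (ii) A transcendental
obstruction would be a closed complex curve `H` of the Stein surface `P² ∖ C₀` avoiding `U`: by Remmert–Stein–Shiffman its
closure meets `C₀` in a set of positive length (finitely many limit points would make `H̄` algebraic), and by the maximum
principle in a Levi-flat chart (`Σₙ ≅ {Im ζ₂ = 0}` locally) it can meet a fin `Σₙ` only by CROSSING it along a real curve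
drawn on the wall surface `dSₙ ∪ Hₙ` (one-sided tangency forces `H ⊂` a leaf).  (iii) Disc-bundle picture: `μ[z] = Re z × Im z`
fibres `P² ∖ ℝP²` over `S²` with fibres the hyperbolic half-leaves, `C₀` the section of centres, `|z·z|/‖z‖² = tanh`(fibre
distance to the centre), the fins = all fibres over the nine wall circles minus the central geodesics, the tube = the
complement of a disc bundle; `ψ = log‖z‖² - log|z·z|` is strictly psh on `P²∖C₀`, so the complement `A` of the envelope is a
closed pseudoconcave set on which `ψ|_A` has no local maximum: every component of `A` runs into `C₀`.  Whether `A = ∅`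
(fins alone force entire profiles) stays open — and is unnecessary after §S.

## §G  ERRATUM (gen 3)

§G's sentence "there is no Bochner-tube / Hartogs mechanism continuing `g` off the fins" is wrong as a global statement and
is withdrawn: for the orthonormal triple `m = ((e₁+e₂)/√2, (e₂-e₁)/√2, e₃)` the three fins form the cross
`⋃ⱼ {ζⱼ ∈ ℂ∖iℝ, ζₖ ∈ ℝ∖0 (k ≠ j)}` in the coordinates `ζⱼ = z·mⱼ`, whose Siciak hull `{∑ⱼ (2/π)·ang(ζⱼ) < 1}`
(`ang` = angle to the real axis; `h_{ℝ₊,{Re>0}} = (2/π)|arg|`) contains the point `cosh b·u_φ + i sinh b·e₁`,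
`u_φ = (0, cos φ, sin φ)`, of the `dS_{e₁}`-line of the generic leaf `(e₁,u_φ)` iff `tanh|b| < cos φ` (triage r1-3;
re-derived: `|arg ζ₁| = |arg ζ₂| = arctan(tanh|b|/cos φ)`, `arg ζ₃ = 0`).  So continuation off the fins exists and reaches
height `artanh(cos φ) → ∞` at the web plane; what §G correctly observes is only that TWO fins are locally a product.
Whether iterated hulls exhaust the leaves is the open envelope question of §T′(iii).
-/

/-! ## §S-formal: consistency, tightness and target lemmas for the two skeletons (gen 3; all sorry-free) -/

/-- The coordinate vectors `e i`. -/
noncomputable def e (i : Fin 3) : E := EuclideanSpace.single i (1:ℝ)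

theorem e_def (i : Fin 3) : (e i : E) = EuclideanSpace.single i (1:ℝ) := rfl

theorem norm_e (i : Fin 3) : ‖(e i : E)‖ = 1 := by
  have h := norm_sq_single_one i
  have hn := norm_nonneg (EuclideanSpace.single i (1:ℝ) : E)
  rw [e_def]
  nlinarith

/-- The packaged target `C⁺` of the picked line (verbatim from `Lines/entire-profile-null-growth.lean`): nine-mirror RP
rigidity for EVERY degree `0 < β < 4`.  TRUE on paper (§S). -/
def NineMirrorRigidityBelowFour : Prop :=
  ∀ (β : ℝ) (K : E → ℝ), 0 < β → β < 4 → PosKernel K → Homog (-β) K → NineInvariant K → NineRP K → Isotropic K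

/-- `C⁺` closes this crux AND item 1979 (the two windows `β = 3-α ∈ (1,2]`, `β = 2Δ ∈ [1,2]` sit inside `(0,4)`);
the stable-cone data `(Φ, potential equation)` and `1 ≤ α` are discarded (cf. §W). -/
theorem of_nineMirrorRigidityBelowFour (h : NineMirrorRigidityBelowFour) :
    PrecisionLaplacian.StableConeRPRigidity ∧ HyperoctahedralRP.HRP2Rigidity := by
  constructor
  · rw [crux_iff]
    intro α Φ K h1 h2 _ hK hhom _ hinv hrp
    refine h (3 - α) K (by linarith) (by linarith) hK ?_ hinv hrp
    intro c hc x
    rw [hhom c hc x, show (-(3 - α) : ℝ) = α - 3 by ring]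
  · intro Δ K hΔ1 hΔ2 hKc hKp hhom hmir R x
    exact h (2 * Δ) K (by linarith) (by linarith) ⟨hKc, hKp⟩ hhom (fun n hn => (hmir n hn).1)
      (fun n hn => (hmir n hn).2) R x

/-- `AxisXRaysRadial` of the picked line (verbatim). -/
def AxisXRaysRadial (K : E → ℝ) : Prop :=
  ∀ (i : Fin 3) (y y' : E), ⟪y, e i⟫ = 0 → ⟪y', e i⟫ = 0 → y ≠ 0 → ‖y‖ = ‖y'‖ →
    ∫ s : ℝ, K (y + s • e i) = ∫ s : ℝ, K (y' + s • e i)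

/-- Consistency of stub S6's conclusion with the crux's: an isotropic kernel has radial axial X-rays
(the reflection in `y - y'` swaps `y, y'` and fixes `e i`). -/
theorem axisXRaysRadial_of_isotropic {K : E → ℝ} (hK : Isotropic K) : AxisXRaysRadial K := by
  intro i y y' hy hy' _ hnorm
  have key : ∀ s : ℝ, K (y' + s • e i) = K (y + s • e i) := by
    intro s
    have h1 : ((ℝ ∙ (y - y'))ᗮ).reflection y = y' := Submodule.reflection_sub hnorm
    have h2 : ((ℝ ∙ (y - y'))ᗮ).reflection (s • e i) = s • e i := by
      apply Submodule.reflection_mem_subspace_eq_self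
      rw [Submodule.mem_orthogonal_singleton_iff_inner_right, inner_smul_right, inner_sub_left, hy, hy']
      simp
    have := hK ((ℝ ∙ (y - y'))ᗮ).reflection (y + s • e i)
    rw [map_add, h1, h2] at this
    exact this
  have hfun : (fun s : ℝ => K (y' + s • e i)) = fun s => K (y + s • e i) := funext key
  rw [hfun]

/-- `EntireMeridianProfiles` of the skeleton `cross-theorem-analyticity` (verbatim, `e₁ = e 0`). -/
def EntireMeridianProfiles (β : ℝ) (K : E → ℝ) : Prop :=
  ∀ u : E, ‖u‖ = 1 → ⟪u, e 0⟫ = 0 →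
    ∃ g : ℂ → ℂ, Differentiable ℂ g ∧
      (∀ ω : ℝ, g ω = ((K (Real.cos ω • u + Real.sin ω • e 0) : ℝ) : ℂ)) ∧
      ∃ C : ℝ, ∀ ω : ℂ, ‖g ω‖ ≤ C * Real.exp (β * |ω.im|)

theorem norm_cos_sin_frame (u : E) (hu : ‖u‖ = 1) (hue : ⟪u, e 0⟫ = 0) (ω : ℝ) :
    ‖Real.cos ω • u + Real.sin ω • e 0‖ = 1 := by
  have he : ‖(e 0 : E)‖ = 1 := norm_e 0
  have heu : ⟪(e 0 : E), u⟫ = 0 := by rw [real_inner_comm]; exact hue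
  have h2 : ‖Real.cos ω • u + Real.sin ω • e 0‖ ^ 2 = 1 := by
    rw [← real_inner_self_eq_norm_sq, inner_add_left, inner_add_right, inner_add_right,
      real_inner_smul_left, real_inner_smul_left, real_inner_smul_left, real_inner_smul_left,
      real_inner_smul_right, real_inner_smul_right, real_inner_smul_right, real_inner_smul_right,
      real_inner_self_eq_norm_sq, real_inner_self_eq_norm_sq, hu, he, hue, heu]
    have := Real.cos_sq_add_sin_sq ω
    nlinarith
  nlinarith [norm_nonneg (Real.cos ω • u + Real.sin ω • e 0)]

/-- Stub S4 (`MeridianGapPinning`) of the skeleton `cross-theorem-analyticity` is CRUX-STRENGTH: its conclusion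
already follows from the crux's conclusion (constant profiles are entire of type `0 ≤ β`). -/
theorem entireMeridianProfiles_of_isotropic {β : ℝ} (hβ : 0 ≤ β) {K : E → ℝ} (hK : Isotropic K) :
    EntireMeridianProfiles β K := by
  intro u hu hue
  refine ⟨fun _ => ((K (e 0) : ℝ) : ℂ), differentiable_const _, ?_, |K (e 0)|, ?_⟩
  · intro ω
    have h := (isotropic_iff_norm K).mp hK (Real.cos ω • u + Real.sin ω • e 0) (e 0)
      (by rw [norm_cos_sin_frame u hu hue ω, norm_e])
    rw [h]
  · intro ω
    rw [Complex.norm_real, Real.norm_eq_abs]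
    have h1 : 1 ≤ Real.exp (β * |ω.im|) := Real.one_le_exp (by positivity)
    nlinarith [abs_nonneg (K (e 0))]

/-- TIGHTNESS of stub S3 (`PeriodicTypeLiouville`) of the picked line: with `β T = 2π` instead of `β T < 2π` the
statement fails — `cos`, period `2π`, type `1`, is not constant.  So the line's window `β < 4` (period `π/2`)
is exactly where mode extinction stops. -/
theorem periodicTypeLiouville_tight :
    ∃ (G : ℂ → ℂ) (T β C : ℝ), 0 < T ∧ 0 ≤ β ∧ β * T = 2 * Real.pi ∧ Differentiable ℂ G ∧
      (∀ ω : ℂ, G (ω + T) = G ω) ∧ (∀ ω : ℂ, ‖G ω‖ ≤ C * Real.exp (β * |ω.im|)) ∧ G 0 ≠ G Real.pi := by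
  refine ⟨Complex.cos, 2 * Real.pi, 1, 1, by positivity, zero_le_one, by ring, Complex.differentiable_cos,
    ?_, ?_, ?_⟩
  · intro ω
    push_cast
    exact Complex.cos_add_two_pi ω
  · intro ω
    have h1 : ‖Complex.exp (ω * Complex.I)‖ ≤ Real.exp |ω.im| := by
      rw [Complex.norm_exp]
      apply Real.exp_le_exp.mpr
      simp [neg_le_abs]
    have h2 : ‖Complex.exp (-ω * Complex.I)‖ ≤ Real.exp |ω.im| := by
      rw [Complex.norm_exp]
      apply Real.exp_le_exp.mpr
      simp [le_abs_self]
    rw [Complex.cos]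
    calc ‖(Complex.exp (ω * Complex.I) + Complex.exp (-ω * Complex.I)) / 2‖
        = ‖Complex.exp (ω * Complex.I) + Complex.exp (-ω * Complex.I)‖ / 2 := by
          rw [norm_div]; norm_num
      _ ≤ (‖Complex.exp (ω * Complex.I)‖ + ‖Complex.exp (-ω * Complex.I)‖) / 2 := by
          gcongr; exact norm_add_le _ _
      _ ≤ (Real.exp |ω.im| + Real.exp |ω.im|) / 2 := by gcongr
      _ = 1 * Real.exp (1 * |ω.im|) := by ring
  · rw [Complex.cos_zero]
    exact_mod_cast (by rw [Complex.cos_pi]; norm_num : (1 : ℂ) ≠ Complex.cos Real.pi)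

/-- Single-mirror reflection positivity (the picked line's `RP K n` at `ι = Fin 3`, verbatim; `NineRP K ↔ ∀ n,
IsMirror n → RPAt K n` by `Iff.rfl`). -/
def RPAt (K : E → ℝ) (n : E) : Prop :=
  ∀ (m : ℕ) (p : Fin m → E) (c : Fin m → ℝ), (∀ a, 0 < ⟪p a, n⟫) →
    0 ≤ ∑ a, ∑ b, c a * c b * K (p a - ((ℝ ∙ n)ᗮ).reflection (p b))

/-- **TARGET (reshaping announced in `PICKED.md`): the AXIAL probe `K·|xᵢ|^{-δ}` is never mirror-RP as a pointwise
kernel.**  For the mirror `e₀ ⊥ e₂` (any of the four mirrors containing the axis `e₂` behaves the same way), every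
diagonal configuration vector `p - θp` lies in the normal line `ℝe₀`, so its `e₂`-coordinate vanishes and the weight
`|0|^{-δ}` is `+∞` on paper and the junk value `0` in Lean; the `2`-point configuration `{e₀ + e₂, e₀}` with
coefficients `(1,-1)` then has quadratic form `-K(2e₀+e₂) - K(2e₀-e₂) < 0`.  Repair: §S, S5. -/
theorem axialProbe_not_RPAt {K : E → ℝ} (hK : ∀ x, x ≠ 0 → 0 < K x) {δ : ℝ} (hδ : δ ≠ 0) :
    ¬ RPAt (fun x => K x * |x 2| ^ (-δ)) (e 0) := by
  intro h
  have hpos : ∀ a : Fin 2, 0 < ⟪(![e 0 + e 2, e 0] : Fin 2 → E) a, e 0⟫ := by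
    intro a
    fin_cases a
    · simp [e, inner_add_left, EuclideanSpace.inner_single_left]
    · simp [e]
  have key := h 2 ![e 0 + e 2, e 0] ![1, -1] hpos
  have v00 : (e 0 + e 2 : E) - ((ℝ ∙ (e 0 : E))ᗮ).reflection (e 0 + e 2) = (2:ℝ) • e 0 := by
    rw [e_def, refl_coord]
    ext k; fin_cases k <;> simp [e_def]
  have v01 : (e 0 + e 2 : E) - ((ℝ ∙ (e 0 : E))ᗮ).reflection (e 0) = (2:ℝ) • e 0 + e 2 := by
    rw [e_def, refl_coord]
    ext k; fin_cases k <;> simp [e_def]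
  have v10 : (e 0 : E) - ((ℝ ∙ (e 0 : E))ᗮ).reflection (e 0 + e 2) = (2:ℝ) • e 0 - e 2 := by
    rw [e_def, refl_coord]
    ext k; fin_cases k <;> simp [e_def]
  have v11 : (e 0 : E) - ((ℝ ∙ (e 0 : E))ᗮ).reflection (e 0) = (2:ℝ) • e 0 := by
    rw [e_def, refl_coord]
    ext k; fin_cases k <;> simp
  have c0 : (((2:ℝ) • e 0 : E) 2) = 0 := by simp [e_def]
  have c1 : (((2:ℝ) • e 0 + e 2 : E) 2) = 1 := by simp [e_def]
  have c2 : (((2:ℝ) • e 0 - e 2 : E) 2) = -1 := by simp [e_def]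
  have hz : (0:ℝ) ^ (-δ) = 0 := Real.zero_rpow (neg_ne_zero.mpr hδ)
  have hK1 : 0 < K ((2:ℝ) • e 0 + e 2) :=
    hK _ (by intro h0; have := congrArg (fun v : E => v 2) h0; simp [e_def] at this)
  have hK2 : 0 < K ((2:ℝ) • e 0 - e 2) :=
    hK _ (by intro h0; have := congrArg (fun v : E => v 2) h0; simp [e_def] at this)
  simp only [Fin.sum_univ_two, Matrix.cons_val_zero, Matrix.cons_val_one, v00, v01, v10, v11,
    c0, c1, c2, abs_zero, abs_one, abs_neg, hz, Real.one_rpow] at key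
  linarith

/-- The Riesz probe of the picked line (verbatim). -/
noncomputable def rieszProbe (γ : ℝ) (K : E → ℝ) : E → ℝ := fun x => K x * ‖x‖ ^ (-γ)

/-- Three of the four conjuncts of stub S5 (`SchurRieszProbe`) hold unconditionally (only nine-RP of the probe needs
the reflection positivity of `‖x‖^{-γ}`, `1 ≤ γ < 3`, and the Schur product theorem). -/
theorem rieszProbe_posKernel {γ : ℝ} {K : E → ℝ} (hK : PosKernel K) : PosKernel (rieszProbe γ K) := by
  refine ⟨?_, ?_⟩
  · apply ContinuousOn.mul hK.1
    apply ContinuousOn.rpow_const continuous_norm.continuousOn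
    intro x hx
    left
    exact norm_ne_zero_iff.mpr hx
  · intro x hx
    unfold rieszProbe
    have h1 := hK.2 x hx
    have h2 : 0 < ‖x‖ := norm_pos_iff.mpr hx
    positivity

theorem rieszProbe_homog {β γ : ℝ} {K : E → ℝ} (h : Homog (-β) K) : Homog (-(β + γ)) (rieszProbe γ K) := by
  intro c hc x
  unfold rieszProbe
  rw [h c hc x, norm_smul, Real.norm_eq_abs, abs_of_pos hc, Real.mul_rpow hc.le (norm_nonneg _),
    show (-(β + γ) : ℝ) = -β + -γ by ring, Real.rpow_add hc]
  ring

theorem rieszProbe_nineInvariant {γ : ℝ} {K : E → ℝ} (h : NineInvariant K) : NineInvariant (rieszProbe γ K) := by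
  intro n hn x
  unfold rieszProbe
  rw [h n hn x, LinearIsometryEquiv.norm_map]


end Summit.CriticalPhenomena.Ising3DConformalLimit.Cruxes.StableConeRPRigidity.Disproof
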